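import Summits.Langlands.Langlands.Theses.QuarterDeficit1951

/-!
# `CorrespondentFingerprint` (stmt-Langlands-15898) — negative knowledge II: parity tightness of
# the weight-0 conclusion

Support lemmas of the standing disprover (`Cruxes/CorrespondentFingerprint/Disproof.lean`, cycle 1,
finding 4; refuter-cdisprove-stmt-Langlands-15898-0, 2026-08-16).

The conclusion of `Summit.Langlands.Langlands.Theses.QuarterDeficit1951.CorrespondentFingerprint`
asks for `u : ℍ → ℂ` with the WEIGHT-ZERO automorphy `u (γ • z) = χ(d_γ) · u z` on `Γ₀(1951)`.
Since `-1 ∈ Γ₀(1951)` acts trivially on `ℍ` and has `d`-entry `-1`, an ODD nebentypus kills every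
such `u` (`eq_zero_of_weightZero_automorphy_odd`), so the odd-character twin of the conclusion is
FALSE (`not_exists_weightZero_form_odd`) — a small-model refutation of the natural variant, and the
automorphic face of the crux's evenness hypothesis: were `det ρ` odd (the sector where reciprocity
IS known, weight-one forms), the typed weight-0 conclusion would fail by parity alone.  Within the
crux the witnessing character has order `5`, hence is even (`even_of_orderOf_odd`,
`even_of_orderOf_eq_five`), and indeed ANY witness of the conclusion has even character
(`even_of_weightZero_witness`), consistent with `ρ.IsEven`.

Nothing here asserts a route statement.  Mathlib + the route file only. [folklore]
-/

noncomputable section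

-- single-conjunct summit `Summits/Langlands/Langlands` (D-0017): the doubled namespace is the tree's layout
set_option linter.dupNamespace false

open scoped MatrixGroups

namespace Summit.Langlands.Langlands.Theorems.CorrespondentFingerprint.Negative

/-- **Odd nebentypus kills weight zero.**  If `u : ℍ → ℂ` satisfies the weight-0 automorphy
`u (γ • z) = χ(d_γ) u z` for all `γ ∈ Γ₀(N)` with an ODD Dirichlet character `χ mod N`, then
`u = 0` (apply it to `γ = -1`, which fixes `z` and has `d = -1`). [folklore] -/
theorem eq_zero_of_weightZero_automorphy_odd {N : ℕ} [NeZero N] (χ : DirichletCharacter ℂ N)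
    (hχ : χ.Odd) (u : UpperHalfPlane → ℂ)
    (hu : ∀ γ : SL(2, ℤ), γ ∈ CongruenceSubgroup.Gamma0 N →
      ∀ z : UpperHalfPlane, u (γ • z) = χ ((γ 1 1 : ℤ) : ZMod N) * u z) :
    ∀ z, u z = 0 := by
  intro z
  -- `-1 ∈ Γ₀(N)` is the tree's `Literature.NumberTheory.Automorphic.neg_one_mem_Gamma0`
  -- (HypFundamentalDomainVolume); re-derived inline to keep this file's imports at the route file.
  have h := hu (-1) (by simp [CongruenceSubgroup.Gamma0_mem]) z
  rw [ModularGroup.SL_neg_smul, one_smul] at h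
  have hd : (((-1 : SL(2, ℤ)) 1 1 : ℤ) : ZMod N) = -1 := by simp
  rw [hd, hχ] at h
  have h2 : (2 : ℂ) * u z = 0 := by linear_combination h
  simpa using h2

/-- **Small-model refutation of the odd twin of the conclusion.**  There is no ODD `χ mod 1951`
with a non-zero `u : ℍ → ℂ` that is weight-0 automorphic of nebentypus `χ` on `Γ₀(1951)` — in
particular none satisfying the full `IsForm χ u (1/4)` clause of `CorrespondentFingerprint`, whose
automorphy conjunct is exactly this one. [folklore] -/
theorem not_exists_weightZero_form_odd :
    ¬ ∃ χ : DirichletCharacter ℂ 1951, χ.Odd ∧ ∃ u : UpperHalfPlane → ℂ,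
      (∀ γ : SL(2, ℤ), γ ∈ CongruenceSubgroup.Gamma0 1951 →
        ∀ z : UpperHalfPlane, u (γ • z) = χ ((γ 1 1 : ℤ) : ZMod 1951) * u z) ∧
      ∃ z, u z ≠ 0 := by
  rintro ⟨χ, hχ, u, hu, z, hz⟩
  exact hz (eq_zero_of_weightZero_automorphy_odd χ hχ u hu z)

/-- A Dirichlet character of ODD order is even (`χ(-1) = ±1` has order dividing `2` and dividing
the odd order). [folklore] -/
theorem even_of_orderOf_odd {N : ℕ} [NeZero N] (χ : DirichletCharacter ℂ N) {m : ℕ}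
    (hm : Odd m) (h : orderOf χ = m) : χ.Even := by
  rcases χ.even_or_odd with he | ho
  · exact he
  · exfalso
    have hm0 : m ≠ 0 := by rintro rfl; exact (Nat.not_odd_zero hm).elim
    have hpow : χ ^ m = 1 := by rw [← h]; exact pow_orderOf_eq_one χ
    have key : (χ ^ m) (-1) = χ (-1) ^ m := MulChar.pow_apply' χ hm0 (-1)
    rw [hpow, ho, MulChar.one_apply (isUnit_one.neg), hm.neg_one_pow] at key
    norm_num at key

/-- Order-5 Dirichlet characters (the nebentypus of the crux's conclusion) are even. [folklore] -/
theorem even_of_orderOf_eq_five {N : ℕ} [NeZero N] (χ : DirichletCharacter ℂ N)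
    (h : orderOf χ = 5) : χ.Even :=
  even_of_orderOf_odd χ (by decide) h

/-- **Any witness of the weight-0 conclusion has even nebentypus** (from `u ≠ 0` alone): the
parity bookkeeping of `CorrespondentFingerprint`'s conclusion is forced, independently of the
order-5 clause. [folklore] -/
theorem even_of_weightZero_witness {N : ℕ} [NeZero N] (χ : DirichletCharacter ℂ N)
    (u : UpperHalfPlane → ℂ)
    (hu : ∀ γ : SL(2, ℤ), γ ∈ CongruenceSubgroup.Gamma0 N →
      ∀ z : UpperHalfPlane, u (γ • z) = χ ((γ 1 1 : ℤ) : ZMod N) * u z)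
    (hne : ∃ z, u z ≠ 0) : χ.Even := by
  rcases χ.even_or_odd with he | ho
  · exact he
  · obtain ⟨z, hz⟩ := hne
    exact (hz (eq_zero_of_weightZero_automorphy_odd χ ho u hu z)).elim

end Summit.Langlands.Langlands.Theorems.CorrespondentFingerprint.Negative

end
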